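/-
Copyright: cell pub-balaban-gaps (YM BLITZ Y1, track G1), seat g1-p2 GEN 4 (unit `pub-balaban-gaps-g1-p2`).  Row (D4) NODE O,
OBJECT ∕ MECHANISM level: the GLUING step [B9] (3.87)–(3.90) in the BLOCK currency (rungs §4–5 of `BLOCKNORM-ADAPTER.md`
composed): the glued inverse `S·(1 − R)⁻¹` of two BLOCK walk expansions is a BLOCK walk expansion whose Neumann margin carries
NO fibre letter.  HONEST FRAMING: bookkeeping over landed hypothesis SHAPES; nothing of Bałaban's constructed or asserted; (D4)
NOT discharged (instance 0∕1); NOT BetaPertH, NOT continuum, NOT Clay.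
-/
import Summits.QuantumFields.BalabanUV.Gaps.D4WalkBlockNeumann

/-!
# `Gaps.D4WalkBlockGlue` — (3.87)–(3.90) in block currency: `S·(1 − R)⁻¹` is a block walk expansion (cell pub-balaban-gaps, seat g1-p2 gen 4)

HONEST DEPENDENCY (cell pub-balaban, verbatim): continuum YM on T⁴ ⇐ BetaPertH ∧ nine spine estimates (0/9 proved);
BetaPertH ⇐ (D1) ∧ (D4) ∧ CAP+tail.

[B9] p. 409 (3.87)–(3.90): `S := Σ_□ h_□G′_□h_□`, `Δ′S = I − R`, `R := Σ_□ K(h_□)G′_□h_□`, `G′ = S(I − R)⁻¹ = Σ_n SRⁿ`, with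
`‖K(h_□)G′_□h_□‖ = O(M⁻¹)` as OPERATOR norms and the count *"N′θc₁(α) < 1 for M sufficiently large"* (Thm 3.7); Thm 3.10
p. 416 the resulting walk expansion.  This is the block-currency twin of `D4WalkGlue` (p355792 ✓): the identity seed
`blockWalkExpansion_one` (`‖1‖_{y,y′} ≤ [y = y′]`, `D4WalkBlock.blockNorm_one_le`), then `(1 − R)⁻¹` by
`D4WalkBlockNeumann.blockWalkExpansion_inv_pencil` at `t = −1`, then `S·(1 − R)⁻¹` by `D4WalkBlockProduct.blockWalkExpansion_mul`.
DIFFERENCE to the flat glue: the margin is `q = c₁·(c₁·1·(1·K̄_R)·c′)·c′` — cube row sums `c₁, c′` at O(1) cube rates and the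
step family's block constant `K̄_R`, NO fibre `m` — and the seed rate ledger reads `ρ + σ₁ ≤ ρ_s ≤ ρ_R` (the identity seed is
free: its blocks are diagonal at every rate).  The algebra `Δ′·(S(1 − R)⁻¹) = 1` from (3.88) is currency-free and already in the
tree (`D4WalkGlue.delta_mul_glue`).  Every hypothesis is a SHAPE or a rate inequality; nothing of Bałaban's (`Δ′`, `G′_□`, `h_□`,
their k-dependence) is constructed.  Value: kernel-checked bookkeeping; words of row (D4) UNCHANGED.
-/

noncomputable section

namespace Summit.QuantumFields.BalabanUV.Gaps.D4WalkBlockGlue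

open Metric Set Finset
open Literature.MathematicalPhysics.QuantumFieldTheory.Balaban1983to89
open Literature.MathematicalPhysics.QuantumFieldTheory.Balaban1983to89.B9SectDWalk (Through MajSumLe DomBy infConv chainConst chainDist)
open Literature.MathematicalPhysics.QuantumFieldTheory.Balaban1983to89.B9Thm34Ext (toB6)
open Literature.MathematicalPhysics.QuantumFieldTheory.Balaban1983to89.B9Thm37GlueTorus (torusGeom tdist1 tdist1_nonneg tdist1_self)
open Literature.MathematicalPhysics.QuantumFieldTheory.Balaban1983to89.TreeLengthTorus (TPt)
open Literature.MathematicalPhysics.QuantumFieldTheory.Balaban1983to89.B5TorusCover (UT)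
open Literature.MathematicalPhysics.QuantumFieldTheory.Balaban1983to89.B11SectG (RowSum)
open Summit.QuantumFields.BalabanUV.Gaps.D4WalkBlock (blockNorm blockNorm_one_le BlockWalkExpansion)
open Summit.QuantumFields.BalabanUV.Gaps.D4WalkProduct (domBy_infConv_torus)
open Summit.QuantumFields.BalabanUV.Gaps.D4WalkNeumann (domBy_chain)
open Summit.QuantumFields.BalabanUV.Gaps.D4WalkBlockProduct (blockWalkExpansion_mul)
open Summit.QuantumFields.BalabanUV.Gaps.D4WalkBlockNeumann (blockWalkExpansion_inv_pencil)

variable {ν : ℕ} {K : Fin ν → ℕ} [∀ i, NeZero (K i)]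
variable {d N' : ℕ} {p n : Type} [Fintype p] [Fintype n] [DecidableEq n]
variable {E : Type*} [NormedAddCommGroup E] [NormedSpace ℂ E]

/-! ## §1. The identity seed in block currency -/

/-- One-term majorant families on `Unit`. -/
private theorem majSumLe_unit {g : B6.Geometry} {K₀ Kbar : g.Site → g.Site → ℝ} (hK : ∀ a b, 0 ≤ K₀ a b)
    (hle : ∀ a b, K₀ a b ≤ Kbar a b) : MajSumLe (fun (_ : Unit) a b => K₀ a b) Kbar := by
  intro S a b
  calc ∑ _ω ∈ S, K₀ a b ≤ ∑ _ω ∈ (Finset.univ : Finset Unit), K₀ a b :=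
        Finset.sum_le_sum_of_subset_of_nonneg (Finset.subset_univ S) fun _ _ _ => hK a b
    _ = K₀ a b := by simp
    _ ≤ Kbar a b := hle a b

/-- The identity family is a one-term BLOCK walk expansion at walk rate `κ + ε`, window `ε`, torus rate `κ`, constant `1`, walk
distance the cube distance `d₁`, no σ-carrying term: its blocks are `‖1‖_{y,y′} ≤ [y = y′] ≤ e^{−(κ+ε)d₁(y,y′)}` at EVERY rate
(the seed of the Neumann step for `(1 − R)⁻¹`). -/
theorem blockWalkExpansion_one (c₀ : B13.Consts) (cubn : n → UT K) (X : Finset (UT K)) (R ε κ : ℝ) :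
    BlockWalkExpansion c₀ cubn cubn (fun (_ : TPt d N' → ℂ) (_ : E) => (1 : Matrix n n ℂ)) X R ε κ 1
      (fun (_ : Unit) (_ : TPt d N' → ℂ) (_ : E) => (1 : Matrix n n ℂ)) (∅ : Set Unit) (fun _ => 1)
      (fun _ => tdist1 K) (κ + ε) where
  hasSum σ _ u _ i j := hasSum_unique (fun _ : Unit => (1 : Matrix n n ℂ) i j)
  termAnalytic _ σ _ i j := differentiableOn_const _
  majB _ σ _ u _ y y' := by
    refine (blockNorm_one_le cubn y y').trans ?_
    split_ifs with h
    · subst h; simp [tdist1_self]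
    · positivity
  majSum := majSumLe_unit (fun a b => by positivity) (fun a b => by simp)
  indep _ _ σ _ := rfl
  through ω hω := by simp at hω
  A_nonneg _ := zero_le_one
  D_nonneg _ a b := tdist1_nonneg a b

/-! ## §2. The glued inverse is a block walk expansion -/

variable {c₀ : B13.Consts} {cub : p → UT K} {cubn : n → UT K} {X : Finset (UT K)}
variable {S : (TPt d N' → ℂ) → E → Matrix p n ℂ} {Rm : (TPt d N' → ℂ) → E → Matrix n n ℂ}
variable {WS WR : Type} {TS : WS → (TPt d N' → ℂ) → E → Matrix p n ℂ} {TR : WR → (TPt d N' → ℂ) → E → Matrix n n ℂ}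
variable {SXS : Set WS} {SXR : Set WR} {AS : WS → ℝ} {AR : WR → ℝ}
variable {DS : WS → UT K → UT K → ℝ} {DR : WR → UT K → UT K → ℝ}
variable {R ρS εS κS KbarS ρR εR κR KbarR ρ ε ρs σ₁ c₁ σ' c' κs κ ρ' ε' κ' : ℝ}

/-- **THE GLUED INVERSE `S·(1 − R)⁻¹` IS A BLOCK WALK EXPANSION — margin WITHOUT fibre** ([B9] (3.87)–(3.90), Thm 3.7 ∕ 3.10 at
one scale, block currency).  Data: block walk expansions of the seed family `S` (`p × n`; rates `ρ_S, ε_S, κ_S`, constant `K̄_S`)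
and of the step family `R` (`n × n`; `ρ_R, ε_R, κ_R, K̄_R`) over the cube maps `cub`, `cubn`, same σ-region and ball, walk
distances dominating the cube distance, cube row sums `(σ₁, c₁)` and `(σ′, c′)`.  STEP 1 (Neumann, `t = −1`, identity seed at
rate `ρ_s + σ₁`): chain rate `ρ`, window `ε`, `0 ≤ ε ≤ ρ`, `ρ + σ₁ ≤ ρ_s ≤ ρ_R`, `ρ_R − ε_R ≤ ρ − ε`, torus rates
`κ + σ′ ≤ κ_s ≤ κ_R`, `κ_s + σ′ ≤ ρ − ε`, `κ ≤ ρ − ε`, margin `q = c₁(c₁·1·(1·K̄_R)c′)c′ < 1` ⟹ `(1 − R)⁻¹` is a block walk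
expansion at `(ρ, ε, κ, 1·(1 − q)⁻¹)`.  STEP 2 (product, the seed pays one cube row sum): `ρ′ + σ₁ ≤ ρ_S`, `ρ′ ≤ ρ`,
`ρ_S − ε_S ≤ ρ′ − ε′`, `ρ − ε ≤ ρ′ − ε′`, `0 ≤ ε′`, `κ′ ≤ κ`, `κ′ + σ′ ≤ κ_S` ⟹ `S·(1 − R)⁻¹` is a block walk expansion at
`(ρ′, ε′, κ′)` with constant `c₁·K̄_S·(1·(1 − q)⁻¹)·c′` (terms ∕ σ-carrying set ∕ amplitudes ∕ distances ∃-packaged; the distances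
dominate `d₁`).  Composition BY NAME of `blockWalkExpansion_one`, `D4WalkBlockNeumann.blockWalkExpansion_inv_pencil` and
`D4WalkBlockProduct.blockWalkExpansion_mul`. [cite: Balaban1985BackgroundPropagators, (3.87)–(3.90) p.409, Thm 3.10 (3.107)–(3.108) p.416; Balaban1988RG2Cluster, (1.11) p.5, p.13, p.15] -/
theorem blockWalkExpansion_glue
    (hS : BlockWalkExpansion c₀ cub cubn S X R εS κS KbarS TS SXS AS DS ρS)
    (hR : BlockWalkExpansion c₀ cubn cubn Rm X R εR κR KbarR TR SXR AR DR ρR)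
    (hSdom : ∀ ω, DomBy (toB6 (torusGeom K 0 0 0) 0 True) (DS ω))
    (hRdom : ∀ ω, DomBy (toB6 (torusGeom K 0 0 0) 0 True) (DR ω))
    (hrow : RowSum (toB6 (torusGeom K 0 0 0) 0 True) σ₁ c₁) (hrow' : RowSum (toB6 (torusGeom K 0 0 0) 0 True) σ' c')
    (hσ₁ : 0 ≤ σ₁) (hσ' : 0 ≤ σ') (hc₁ : 0 ≤ c₁) (hc' : 0 ≤ c')
    -- step 1: the Neumann window
    (hε : 0 ≤ ε) (hερ : ε ≤ ρ) (hρs : ρ + σ₁ ≤ ρs) (hρsR : ρs ≤ ρR) (hwR : ρR - εR ≤ ρ - ε)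
    (hKR : 0 ≤ KbarR) (hκs : 0 ≤ κs) (hκsR : κs ≤ κR) (hκsC : κs + σ' ≤ ρ - ε) (hκ : 0 ≤ κ) (hκC : κ ≤ ρ - ε)
    (hκκs : κ + σ' ≤ κs)
    (hq : c₁ * (c₁ * 1 * (1 * KbarR) * c') * c' < 1)
    -- step 2: the product window (seed pays)
    (hρ' : 0 ≤ ρ') (hρ'ρ : ρ' ≤ ρ) (hρ'S : ρ' + σ₁ ≤ ρS) (hε' : 0 ≤ ε') (hwS : ρS - εS ≤ ρ' - ε') (hw1 : ρ - ε ≤ ρ' - ε')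
    (hKS : 0 ≤ KbarS) (hκ' : 0 ≤ κ') (hκ'κ : κ' ≤ κ) (hκ'S : κ' + σ' ≤ κS) :
    ∃ (W : Type) (T : W → (TPt d N' → ℂ) → E → Matrix p n ℂ) (SX : Set W) (A : W → ℝ) (D : W → UT K → UT K → ℝ)
      (ρ₀ : ℝ), BlockWalkExpansion c₀ cub cubn (fun σ₀ u => S σ₀ u * ((1 : Matrix n n ℂ) + (-1 : ℂ) • Rm σ₀ u)⁻¹) X R ε' κ'
        (c₁ * KbarS * (1 * (1 - c₁ * (c₁ * 1 * (1 * KbarR) * c') * c')⁻¹) * c') T SX A D ρ₀ ∧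
      ∀ ω, DomBy (toB6 (torusGeom K 0 0 0) 0 True) (D ω) := by
  -- step 1: (1 − R)⁻¹ = (1 + (−1)•R)⁻¹ by the block Neumann step with the identity seed at rate ρ_s + σ₁, window down to ρ − ε
  have hone := blockWalkExpansion_one (d := d) (N' := N') (E := E) c₀ cubn X R (ρs + σ₁ - (ρ - ε)) (ρ - ε)
  have hinv := blockWalkExpansion_inv_pencil (A := fun (_ : TPt d N' → ℂ) (_ : E) => (1 : Matrix n n ℂ))
    (t := (-1 : ℂ)) (τ := 1) (ρ := ρ) (ε := ε) (ρs := ρs) (κs := κs) (κ := κ)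
    hone hR (fun _ a b => le_rfl) hRdom (fun σ₀ _ u _ => Matrix.one_mul _) hrow hrow' hσ₁ hσ' hc₁ hc'
    hε hερ hρs (by linarith) hρsR (by linarith) hwR zero_le_one hKR hκs hκsR hκsC hκ hκC hκκs zero_le_one (by simp) hq
  -- step 2: S · (1 − R)⁻¹, the seed pays the middle cube row sum
  have hq1 : 0 < 1 - c₁ * (c₁ * 1 * (1 * KbarR) * c') * c' := by linarith
  have hCdom : ∀ ω : List (Unit × WR) × Unit, DomBy (toB6 (torusGeom K 0 0 0) 0 True)
      (chainDist (g := toB6 (torusGeom K 0 0 0) 0 True)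
        (fun i : Unit × WR => infConv (g := toB6 (torusGeom K 0 0 0) 0 True) (tdist1 K) (DR i.2)) (tdist1 K) ω.1) :=
    fun ω => domBy_chain (DC := fun _ : Unit => tdist1 K) (fun _ a b => le_rfl) hRdom ω
  have hmul := blockWalkExpansion_mul (ρ := ρ') (ε := ε') (κ := κ') hS hinv hSdom hCdom hrow hrow' hρ' hρ'ρ hσ₁ hρ'S
    hε' hwS hw1 hKS (by positivity) hκ' hκ'κ hκ'S hc₁
  exact ⟨_, _, _, _, _, _, hmul, fun ω => domBy_infConv_torus (hSdom ω.1) (hCdom ω.2)⟩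

end Summit.QuantumFields.BalabanUV.Gaps.D4WalkBlockGlue

end
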